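import Literature.AlgebraicGeometry.GroupSchemes.CartierDualQuotientArtinian
import Mathlib.RingTheory.OrzechProperty
import Mathlib.LinearAlgebra.Dimension.Free
import HarnessLib

/-!
# The Cartier–Tate quotient over a noetherian LOCAL base, II: `(H^⊥)^⊥ = H` by rank, and the kernel of `G → G⧸H` is exactly `H`
# (Tate 1997 (3.7)–(3.8))

Layer `Literature/AlgebraicGeometry/GroupSchemes`, namespace `Literature.AlgebraicGeometry.GroupSchemes.AffineGroupScheme` (sequel of ★ `CartierDualQuotientArtinian`
— `j^D` faithfully flat, `Γ(H^⊥)` free, `G → G⧸H` flat and surjective over a noetherian local base —; field ancestors ★ `CartierDualDoubleAnnihilator`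
(`(H^⊥)^⊥ = ε_G⁻¹(H)`), ★ `CartierDualQuotient` §Field (`exists_iso_ker_quotProj`), ★ `CartierDualLagrangian` (`isIso_of_isClosedImmersion_of_finrank_alg_eq`)).
THEOREMS ONLY (no definition, no instance, no notation, no named fact, no `sorry`).  Cell `hodgecm-mathlib` (D-0151), programme P6b wave A seat A3 (E2b-S1), prover
LA2-p03 (g9), 2026-09-03: it pays the stub `stub_E2bCT_quotProjFaithfullyFlat` (CT2) of the HOME sub-line cand `F0_P6b_Sigma2ImageQuot.ed1.cand.v1`
dfae2a4261ab78b9 BY TYPE (§3, token for token).  Count-neutral Mathlib-side capital: HC_CM is proved only modulo the printed citations until rung 0 closes.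

THE PRINT ([Tate1997FiniteFlatGroupSchemes] (3.7): `G → G⧸H` is faithfully flat WITH KERNEL `H`; §(3.8) p. 146: duality is exact, so `H = (H^⊥)^⊥` under
`G ≅ (G^D)^D`; [Matsumura1987] Thm. 2.4 ∕ 7.10 and [StacksProject] Tag 02KA: a closed immersion of finite flat schemes of equal rank is an isomorphism).
For `j : H ⟶ G` as in part I over a noetherian LOCAL ring `R` with `Γ(H^⊥)` free:

* §1 (any `R`) `isIso_of_bijective_comap'` (★ `isIso_of_bijective_comap` verbatim over a ring), **`isIso_of_isClosedImmersion_of_finrank_alg_eq_of_free`** —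
  EQUAL-RANK RIGIDITY for affine `R`-schemes with finite FREE algebras (`Γ(ψ)` surjective ★ `surjective_comap_of_isClosedImmersion`; injective by
  Vasconcelos ∕ Orzech, Mathlib `OrzechProperty.injective_of_surjective_of_injective`).
* §2 `finrank_alg_pos'` (`rk Γ(G) > 0` over a nontrivial base); the rank clause `rk Γ(H^⊥) · rk Γ(H) = rk Γ(G)` for free `Γ(H^⊥)` is read IN-PROOF from ★
  `finrank_tensor_alg_annihilator_mul_finrank` at the residue field + Mathlib `Module.finrank_baseChange` (its local-domain form is ★ `finrank_alg_annihilator_mul_finrank_of_isLocalRing`).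
* §3 (`R` noetherian local, `Γ(H^⊥)` free) `comp_inv_comp_cartierDualMap_annihilatorι` (`(j ≫ ε_G⁻¹) ≫ (ι_{H^⊥})^D = 1`),
  **`isIso_kerLift_comp_cartierDualBidualIso_inv`** — THE DOUBLE ANNIHILATOR: the comparison `H → (H^⊥)^⊥` is an isomorphism (closed immersion of equal rank,
  `Γ((H^⊥)^⊥)` free by part I at `ι_{H^⊥}`), **`comp_quotProj_eq_one_iff : u ≫ quotProj j = 1 ↔ ∃ v, v ≫ j = u`** — THE KERNEL OF `G → G⧸H` IS `H` —, and the
  Artinian-local package **`quotProj_flat_surjective_ker_of_isArtinianRing`** = the TYPE of the P6b stub CT2.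

## References
* [Tate1997FiniteFlatGroupSchemes] J. Tate, *Finite flat group schemes*, in: Modular Forms and Fermat's Last Theorem (1997), (3.7), §(3.8) pp. 145–146.
* [Matsumura1987] H. Matsumura, *Commutative Ring Theory* (1987), Thm. 2.4, Thm. 7.10.
* [StacksProject] The Stacks Project, Tag 02KA (rank of a finite locally free morphism), Tag 05GD (Vasconcelos ∕ Orzech).
* [EGAIV3] A. Grothendieck, J. Dieudonné, *ÉGA* IV₃ (1966), Thm. 11.3.10; [Waterhouse1979] GTM 66, §14.1, §2.1.
-/

set_option autoImplicit false

-- Mathlib's `Over`/`Scheme` APIs are stated across semireducible wrappers (as in the ★ `GroupSchemes/*` files).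
set_option backward.isDefEq.respectTransparency false

universe u

open CategoryTheory CategoryTheory.Limits AlgebraicGeometry MonoidalCategory CartesianMonoidalCategory TensorProduct WithConv

noncomputable section

namespace Literature.AlgebraicGeometry.GroupSchemes

namespace AffineGroupScheme

open scoped MonObj CategoryTheory.Obj

open Literature.AlgebraicGeometry.Motives Literature.NumberTheory.DiophantineGeometry Literature.RingTheory.HopfAlgebra GroupSchemeKernel
open Literature.AlgebraicGeometry.Morphisms

/-! ## §1 Equal-rank rigidity over any base: a closed immersion between finite FREE affine `R`-schemes of the same rank is an isomorphism -/

section Rigidity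

variable {R : Type u} [CommRing R] {X Y : SchemeOver R} [IsAffine X.left] [IsAffine Y.left] (ψ : X ⟶ Y)

/-- An `R`-morphism of affine schemes whose map on global sections is bijective is an isomorphism (Mathlib: isomorphisms have the affine property
«affine source and `Γ` an isomorphism»; `Over.forget` reflects isomorphisms; ★ `isIso_of_bijective_comap` over a field, verbatim over `R`).
[cite: Waterhouse1979, §14.1 Theorem] -/
theorem isIso_of_bijective_comap' (hψ : Function.Bijective (Alg.comap ψ)) : IsIso ψ := by
  haveI : IsIso ψ.left.appTop := (ConcreteCategory.isIso_iff_bijective ψ.left.appTop).mpr hψ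
  have hP : (MorphismProperty.isomorphisms Scheme) ψ.left :=
    (HasAffineProperty.iff_of_isAffine (P := MorphismProperty.isomorphisms Scheme)).mpr ⟨inferInstance, inferInstance⟩
  haveI : IsIso ψ.left := (MorphismProperty.isomorphisms.iff _).mp hP
  haveI : IsIso ((Over.forget _).map ψ) := by simpa using (inferInstance : IsIso ψ.left)
  exact isIso_of_reflects_iso ψ (Over.forget _)

/-- **EQUAL-RANK RIGIDITY**: a morphism `ψ : X → Y` of affine `R`-schemes whose underlying morphism is a closed immersion and whose algebras
`Γ(X)`, `Γ(Y)` are finite FREE `R`-modules of the SAME rank is an isomorphism — `Γ(ψ) : Γ(Y) ↠ Γ(X)` is surjective (★ `surjective_comap_of_isClosedImmersion`),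
and a surjective linear map onto a finite module that is abstractly isomorphic to the source is injective (Vasconcelos ∕ Orzech, Mathlib
`OrzechProperty.injective_of_surjective_of_injective`); an affine morphism with bijective `Γ` is an isomorphism.  The field case is ★
`isIso_of_isClosedImmersion_of_finrank_alg_eq`. [cite: Matsumura1987, Thm. 2.4 and Thm. 7.10] [cite: StacksProject, Tag 02KA] -/
theorem isIso_of_isClosedImmersion_of_finrank_alg_eq_of_free [Nontrivial R] [IsClosedImmersion ψ.left]
    [Module.Free R (Alg X)] [Module.Finite R (Alg X)] [Module.Free R (Alg Y)] [Module.Finite R (Alg Y)]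
    (h : Module.finrank R (Alg X) = Module.finrank R (Alg Y)) : IsIso ψ := by
  have hsurj : Function.Surjective (Alg.comap ψ) := surjective_comap_of_isClosedImmersion ψ
  let e : Alg Y ≃ₗ[R] Alg X := LinearEquiv.ofFinrankEq (Alg Y) (Alg X) h.symm
  have hinj : Function.Injective (Alg.comap ψ) :=
    OrzechProperty.injective_of_surjective_of_injective e.toLinearMap (Alg.comap ψ).toLinearMap e.injective hsurj
  exact isIso_of_bijective_comap' ψ ⟨hinj, hsurj⟩

end Rigidity

/-! ## §2 `Γ(G)` has positive rank -/

section Rank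

variable {R : Type u} [CommRing R] [IsLocalRing R] {H G : SchemeOver R}
  [GrpObj H] [IsCommMonObj H] [IsAffine H.left] [Module.Free R (Alg H)] [Module.Finite R (Alg H)]
  [GrpObj G] [IsCommMonObj G] [IsAffine G.left] [Module.Free R (Alg G)] [Module.Finite R (Alg G)]
  (j : H ⟶ G) [IsMonHom j] [IsClosedImmersion j.left] [Module.Free R (Alg (annihilator j))]

omit [IsLocalRing R] [IsClosedImmersion j.left] [Module.Free R (Alg (annihilator j))] [GrpObj H] [IsCommMonObj H] [IsAffine H.left]
  [Module.Free R (Alg H)] [Module.Finite R (Alg H)] [IsMonHom j] [IsCommMonObj G] in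
/-- `Γ(G)` has POSITIVE rank over a nontrivial base: it is a nontrivial ring (it maps to `R` by the counit) and a free module. [cite: Waterhouse1979, §2.1 p. 14] -/
theorem finrank_alg_pos' [Nontrivial R] : 0 < Module.finrank R (Alg G) := by
  haveI : Nontrivial (Alg G) := (Bialgebra.counitAlgHom R (Alg G)).toRingHom.domain_nontrivial
  exact (Module.finrank_pos_iff_of_free R (Alg G)).mpr inferInstance

end Rank

/-! ## §3 Over a noetherian LOCAL base: `H = (H^⊥)^⊥` under `G ≅ (G^D)^D`, and the kernel of `G → G⧸H` is `H` -/

section Kernel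

variable {R : Type u} [CommRing R] [IsNoetherianRing R] [IsLocalRing R] {H G : SchemeOver R}
  [GrpObj H] [IsCommMonObj H] [IsAffine H.left] [Module.Free R (Alg H)] [Module.Finite R (Alg H)]
  [GrpObj G] [IsCommMonObj G] [IsAffine G.left] [Module.Free R (Alg G)] [Module.Finite R (Alg G)]
  (j : H ⟶ G) [IsMonHom j] [IsClosedImmersion j.left] [Module.Free R (Alg (annihilator j))]

omit [IsNoetherianRing R] [IsLocalRing R] [IsClosedImmersion j.left] in
/-- `(j ≫ ε_G⁻¹) ≫ (ι_{H^⊥})^D = 1` — `H` pairs trivially with its annihilator (★ `comp_quotProj : j ≫ quotProj j = 1`, ★ `quotProj_def`).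
[cite: Tate1997FiniteFlatGroupSchemes, §(3.8) p. 146] -/
theorem comp_inv_comp_cartierDualMap_annihilatorι :
    (j ≫ (cartierDualBidualIso G).inv) ≫ cartierDualMap (annihilatorι j) = 1 := by
  rw [Category.assoc, ← quotProj_def]
  exact comp_quotProj j

/-- **THE DOUBLE ANNIHILATOR OVER A NOETHERIAN LOCAL BASE: the comparison `H → (H^⊥)^⊥` (over `G ≅ (G^D)^D`) is an ISOMORPHISM** when `Γ(H^⊥)` is free:
it is a closed immersion (it lies over the closed immersion `j ≫ ε_G⁻¹` through the closed immersion `ι_{(H^⊥)^⊥}`), `Γ((H^⊥)^⊥)` is free (★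
`flat_hom_and_free_alg_annihilator` applied to the closed immersion `ι_{H^⊥} : H^⊥ ↪ G^D` of finite free group schemes), and the ranks agree:
`rk (H^⊥)^⊥ · rk H^⊥ = rk G^D = rk G = rk H^⊥ · rk H` (★ fibre-rank constancy at `κ`, twice).  Field case: ★ `exists_iso_annihilator_annihilatorι`.
[cite: Tate1997FiniteFlatGroupSchemes, §(3.8) pp. 145–146] [cite: StacksProject, Tag 02KA] -/
theorem isIso_kerLift_comp_cartierDualBidualIso_inv :
    IsIso (kerLift (f := cartierDualMap (annihilatorι j)) (j ≫ (cartierDualBidualIso G).inv)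
      (comp_inv_comp_cartierDualMap_annihilatorι j)) := by
  haveI := isClosedImmersion_annihilatorι_left j
  haveI : Module.Free R (Alg (annihilator (annihilatorι j))) := (flat_hom_and_free_alg_annihilator (annihilatorι j)).2
  haveI := isClosedImmersion_annihilatorι_left (annihilatorι j)
  -- the comparison map is a closed immersion
  haveI : IsIso ((Over.forget (Spec (.of R))).map (cartierDualBidualIso G).inv) := inferInstance
  haveI : IsIso (cartierDualBidualIso G).inv.left := by simpa using (inferInstance : IsIso ((Over.forget (Spec (.of R))).map (cartierDualBidualIso G).inv))
  haveI : IsClosedImmersion ((kerLift (f := cartierDualMap (annihilatorι j)) (j ≫ (cartierDualBidualIso G).inv)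
      (comp_inv_comp_cartierDualMap_annihilatorι j)).left ≫ (annihilatorι (annihilatorι j)).left) := by
    rw [← Over.comp_left, show annihilatorι (annihilatorι j) = kerι (cartierDualMap (annihilatorι j)) from rfl, kerLift_ι, Over.comp_left]
    infer_instance
  haveI : IsClosedImmersion (kerLift (f := cartierDualMap (annihilatorι j)) (j ≫ (cartierDualBidualIso G).inv)
      (comp_inv_comp_cartierDualMap_annihilatorι j)).left :=
    IsClosedImmersion.of_comp _ (annihilatorι (annihilatorι j)).left
  -- ranks: `rk (H^⊥)^⊥ · rk H^⊥ = rk G = rk H^⊥ · rk H`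
  -- `rk Γ(H^⊥) · rk Γ(H) = rk Γ(G)` and `rk Γ((H^⊥)^⊥) · rk Γ(H^⊥) = rk Γ(G^D) = rk Γ(G)`: the residual fibre ranks (★ `finrank_tensor_alg_annihilator_mul_finrank`
  -- at `κ`) are the ranks of the free modules (Mathlib `Module.finrank_baseChange`); cf. ★ `finrank_alg_annihilator_mul_finrank_of_isLocalRing` (local domains)
  have hA : Module.finrank R (Alg (annihilator j)) * Module.finrank R (Alg H) = Module.finrank R (Alg G) := by
    have h := finrank_tensor_alg_annihilator_mul_finrank (IsLocalRing.ResidueField R) j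
    rwa [Module.finrank_baseChange] at h
  have hB : Module.finrank R (Alg (annihilator (annihilatorι j))) * Module.finrank R (Alg (annihilator j)) =
      Module.finrank R (Alg G) := by
    have h := finrank_tensor_alg_annihilator_mul_finrank (IsLocalRing.ResidueField R) (annihilatorι j)
    rwa [Module.finrank_baseChange, finrank_alg_cartierDual] at h
  have hpos : 0 < Module.finrank R (Alg (annihilator j)) := by
    rcases Nat.eq_zero_or_pos (Module.finrank R (Alg (annihilator j))) with h0 | h0
    · exfalso
      have hg := finrank_alg_pos' (G := G)
      rw [← hA, h0, zero_mul] at hg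
      exact lt_irrefl 0 hg
    · exact h0
  have hrk : Module.finrank R (Alg H) = Module.finrank R (Alg (annihilator (annihilatorι j))) := by
    apply Nat.eq_of_mul_eq_mul_left hpos
    rw [hA, ← hB, mul_comm]
  haveI : IsAffine (ker (cartierDualMap (annihilatorι j))).left := inferInstanceAs (IsAffine (annihilator (annihilatorι j)).left)
  haveI : Module.Finite R (Alg (ker (cartierDualMap (annihilatorι j)))) :=
    inferInstanceAs (Module.Finite R (Alg (annihilator (annihilatorι j))))
  haveI : Module.Free R (Alg (ker (cartierDualMap (annihilatorι j)))) := ‹Module.Free R (Alg (annihilator (annihilatorι j)))›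
  exact isIso_of_isClosedImmersion_of_finrank_alg_eq_of_free _ hrk

/-- **THE KERNEL OF `G → G⧸H` IS EXACTLY `H`** over a noetherian local base with `Γ(H^⊥)` free ([Tate1997FiniteFlatGroupSchemes] (3.7)): a `T`-point
`u` of `G` dies in `G⧸H = (H^⊥)^D` iff it factors through `j : H ↪ G`.  (⇐) ★ `comp_comp_quotProj`; (⇒) `u ≫ ε_G⁻¹` lies in `(H^⊥)^⊥ = ker (ι_{H^⊥})^D`,
which IS `H` by `isIso_kerLift_comp_cartierDualBidualIso_inv`.  Field case: ★ `exists_iso_ker_quotProj`. [cite: Tate1997FiniteFlatGroupSchemes, (3.7)]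
[cite: Tate1997FiniteFlatGroupSchemes, §(3.8) p. 146] -/
theorem comp_quotProj_eq_one_iff {T : SchemeOver R} (u : T ⟶ G) :
    u ≫ quotProj j = 1 ↔ ∃ v : T ⟶ H, v ≫ j = u := by
  constructor
  · intro hu
    haveI := isIso_kerLift_comp_cartierDualBidualIso_inv j
    set c := kerLift (f := cartierDualMap (annihilatorι j)) (j ≫ (cartierDualBidualIso G).inv)
      (comp_inv_comp_cartierDualMap_annihilatorι j) with hc
    have hu' : (u ≫ (cartierDualBidualIso G).inv) ≫ cartierDualMap (annihilatorι j) = 1 := by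
      rw [Category.assoc, ← quotProj_def]; exact hu
    -- `j = c ≫ ι ≫ ε_G`, so `c⁻¹ ≫ j = ι ≫ ε_G`
    have hj : inv c ≫ j = kerι (cartierDualMap (annihilatorι j)) ≫ (cartierDualBidualIso G).hom := by
      rw [IsIso.inv_comp_eq, ← Category.assoc, hc, kerLift_ι, Category.assoc, Iso.inv_hom_id, Category.comp_id]
    refine ⟨kerLift (f := cartierDualMap (annihilatorι j)) (u ≫ (cartierDualBidualIso G).inv) hu' ≫ inv c, ?_⟩
    rw [Category.assoc, hj, ← Category.assoc, kerLift_ι, Category.assoc, Iso.inv_hom_id, Category.comp_id]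
  · rintro ⟨v, rfl⟩
    exact comp_comp_quotProj j v

/-- **CT2 — THE CARTIER–TATE QUOTIENT MAP `G → G⧸H` IS FLAT AND SURJECTIVE WITH KERNEL EXACTLY `H`, over an Artinian local base** (the statement of the
P6b line's stub `stub_E2bCT_quotProjFaithfullyFlat`, token for token; [Tate1997FiniteFlatGroupSchemes] (3.7)): ★ `flat_quotProj_left_of_isNoetherianRing`,
★ `surjective_quotProj_left_of_free`, `comp_quotProj_eq_one_iff` (an Artinian ring is noetherian, Akizuki). [cite: Tate1997FiniteFlatGroupSchemes, (3.7)]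
[cite: EGAIV3, Thm. 11.3.10] -/
theorem quotProj_flat_surjective_ker_of_isArtinianRing :
    ∀ (A : Type) [CommRing A] [IsArtinianRing A] [IsLocalRing A] (H G : SchemeOver A)
      [GrpObj H] [IsCommMonObj H] [IsAffine H.left] [Module.Free A (Alg H)] [Module.Finite A (Alg H)]
      [GrpObj G] [IsCommMonObj G] [IsAffine G.left] [Module.Free A (Alg G)] [Module.Finite A (Alg G)]
      (j : H ⟶ G) [IsMonHom j] [IsClosedImmersion j.left] [Module.Free A (Alg (annihilator j))],
      Flat (quotProj j).left ∧ Surjective (quotProj j).left ∧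
        ∀ (T : SchemeOver A) (u : T ⟶ G), u ≫ quotProj j = 1 ↔ ∃ v : T ⟶ H, v ≫ j = u := by
  intro A _ _ _ H G _ _ _ _ _ _ _ _ _ _ j _ _ _
  exact ⟨flat_quotProj_left_of_isNoetherianRing j, surjective_quotProj_left_of_free j, fun T u => comp_quotProj_eq_one_iff j u⟩

end Kernel

end AffineGroupScheme

end Literature.AlgebraicGeometry.GroupSchemes

end
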